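import Literature.NumberTheory.GaloisRepresentations.LubinTateColemanRelativeBaseNormTwo
import Literature.NumberTheory.GaloisRepresentations.LubinTateColemanRelativeExactPrincipalTwo
import Literature.NumberTheory.GaloisRepresentations.LubinTateColemanRelativeAnomalyTwo
import HarnessLib

/-!
# Laws of the norm down the unramified base at `q = 2`: transitivity, `Γ_F`-equivariance, `N_{E₂/E₁}(ιγ) = γ^{[E₂:E₁]}`,
# and the cokernel of `β ↦ r_β` is killed by `1 − u^{[E:F]}`

De Shalit, *Iwasawa theory of elliptic curves with complex multiplication* (1987), Ch. I §3.7–3.8 and Ch. III §1.2–1.3: the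
norms `N_{k''/k'}` along the unramified layers `k'` of the two-variable local tower form an INVERSE SYSTEM of `Γ_F`-modules
(the transition maps of `𝒰 = lim←`), compatible with the inclusions (`N ∘ ι = [k'':k']`-th power), and at each layer the cokernel of
Theorem I.3.7 is `(𝒪/p^N)(1)` with `p^N ∥ p^dξ^{-1} − 1` — in the coordinates `r_β ∈ 𝒪_E⟦Y⟧` of the tree (`π = 2u`, `d = [E:F]`):
`𝒪_E⟦Y⟧ / r(𝒰¹)` is `𝒪_E/(1 − uφ)𝒪_E`, KILLED BY `1 − u^d` (`(1 − uφ) ∘ Σ_{i<d} u^iφ^i = 1 − u^dφ^d = 1 − u^d`).  Sequel to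
`LubinTateColemanRelativeBaseNormTwo`; everything PROVED (0 sorry, no named facts):

* `RelNormCoherentUnits.baseNorm_baseNorm` — **transitivity** `N_{E₂/E₁} ∘ N_{E₃/E₂} = N_{E₃/E₁}`;
* `RelNormCoherentUnits.baseNorm_galAct` — **`Γ_F`-equivariance** `N(σ̃·β) = σ̃·N(β)`;
* `RelNormCoherentUnits.npow`, `val_npow`, `relColemanSeries_npow`, `relLogDerivSeries_npow`, `relUnitCoordTwo_npow` (`g_{β^n} = g_β^n`,
  `r_{β^n} = n·r_β`); `finrank_towerAlgebra_sup_ltField` (`[E₂·K_π^{m+1} : E₁·K_π^{m+1}] = [E₂:F]/[E₁:F]`);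
  ★ `RelNormCoherentUnits.baseNorm_baseChange` — **`N_{E₂/E₁}(ι γ) = γ^{[E₂:F]/[E₁:F]}`**, hence `r ↦ [E₂:E₁]·r` on coordinates
  (`relUnitCoordTwo_baseNorm_baseChange`);
* `exists_sub_mul_frobUnitBall_eq` — `∀ c ∃ c', c' − u·φ(c') = (1 − u^{[E:F]})·c` (`φ^{[E:F]} = id`), and
  ★ `exists_principal_relUnitCoordTwo_eq_of_constantCoeff_eq` — **every `r ∈ 𝒪_E⟦Y⟧` with `r(0) ∈ (1 − u^{[E:F]})𝒪_E` is `r_β` for a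
  principal `β`**: the cokernel of `𝒰¹(E·K_π^∞) → 𝒪_E⟦Y⟧` is killed by `1 − u^{[E:F]}` (de Shalit's `p^N`; for characteristic
  ideals over `ℤ_p⟦T₁,T₂⟧` these cokernels are pseudo-null).

## References

* E. de Shalit, *Iwasawa theory of elliptic curves with complex multiplication* (1987), Ch. I §3.7 Theorem, §3.8 (16); Ch. III §1.2
  Lemma (ii), §1.3. [deShalit1987]
-/

noncomputable section

open scoped PowerSeries.WithPiTopology

namespace Literature.NumberTheory.GaloisRepresentations

section RelativeBaseNormLawsTwo

open GaloisRepresentations.IsNonarchimedeanLocalField LubinTate ValuativeRel Field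

variable {F : Type} [Field F] [ValuativeRel F] [TopologicalSpace F] [IsNonarchimedeanLocalField F]

attribute [local instance] ltNormUniformSpace ltNormIsUniformAddGroup rk1 nF nE fintypeResidueField

variable {π : 𝒪[F]} (hπ : (valuation F).IsUniformizer (π : F))

/-! ### Transitivity and `Γ_F`-equivariance of the norm down the base -/

namespace RelNormCoherentUnits

variable {E₁ E₂ E₃ : IntermediateField F (AlgebraicClosure F)} [FiniteDimensional F E₁] [FiniteDimensional F E₂]
  [FiniteDimensional F E₃]

/-- **Transitivity**: `N_{E₂/E₁}(N_{E₃/E₂} β) = N_{E₃/E₁} β` for `E₁ ≤ E₂ ≤ E₃` (transitivity of the finite-level norms).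
[cite: deShalit1987, Ch. III §1.2 Lemma (ii)] -/
theorem baseNorm_baseNorm [IsGalois F E₂] [IsGalois F E₃] (h₁₂ : E₁ ≤ E₂) (h₂₃ : E₂ ≤ E₃) (β : RelNormCoherentUnits hπ E₃) :
    (β.baseNorm hπ h₂₃).baseNorm hπ h₁₂ = β.baseNorm hπ (h₁₂.trans h₂₃) := by
  refine RelNormCoherentUnits.ext fun m => Subtype.ext ?_
  rw [coe_val_baseNorm, coe_val_baseNorm, coe_val_baseNorm, towerNorm_towerNorm]

/-- **`Γ_F`-equivariance**: `N_{E₂/E₁}(σ̃·β) = σ̃·N_{E₂/E₁}(β)` for every `σ̃ ∈ Γ_F` (`E₁`, `E₂` normal): automorphisms commute with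
the finite-level norms (Mathlib `Algebra.norm_eq_of_equiv_equiv`). [cite: deShalit1987, Ch. I §3.4 Lemma (ii), §3.8 (16)] -/
theorem baseNorm_galAct [Normal F E₁] [IsGalois F E₂] (h : E₁ ≤ E₂) (σ : absoluteGaloisGroup F) (β : RelNormCoherentUnits hπ E₂) :
    (β.galAct σ).baseNorm hπ h = (β.baseNorm hπ h).galAct σ := by
  refine RelNormCoherentUnits.ext fun m => Subtype.ext ?_
  rw [coe_val_baseNorm, coe_val_galAct, coe_val_galAct, coe_val_baseNorm]
  letI := towerAlgebra (sup_le_sup_right h (ltField π m) : E₁ ⊔ ltField π m ≤ E₂ ⊔ ltField π m)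
  have hc : (algebraMap (E₁ ⊔ ltField π m : IntermediateField F (AlgebraicClosure F))
      (E₂ ⊔ ltField π m : IntermediateField F (AlgebraicClosure F))).comp (relRestrict hπ E₁ m σ).toRingEquiv.toRingHom =
      (relRestrict hπ E₂ m σ).toRingEquiv.toRingHom.comp (algebraMap (E₁ ⊔ ltField π m : IntermediateField F (AlgebraicClosure F))
        (E₂ ⊔ ltField π m : IntermediateField F (AlgebraicClosure F))) := by
    refine RingHom.ext fun y => Subtype.ext ?_
    change (((IntermediateField.inclusion (sup_le_sup_right h (ltField π m)) (relRestrict hπ E₁ m σ y)) :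
        (E₂ ⊔ ltField π m : IntermediateField F (AlgebraicClosure F))) : AlgebraicClosure F) =
      ((relRestrict hπ E₂ m σ (IntermediateField.inclusion (sup_le_sup_right h (ltField π m)) y) :
        (E₂ ⊔ ltField π m : IntermediateField F (AlgebraicClosure F))) : AlgebraicClosure F)
    rw [IntermediateField.coe_inclusion, coe_relRestrict_apply, coe_relRestrict_apply, IntermediateField.coe_inclusion]
  have e := Algebra.norm_eq_of_equiv_equiv (relRestrict hπ E₁ m σ).toRingEquiv (relRestrict hπ E₂ m σ).toRingEquiv hc
    ((β.val m : unitBall (E₂ ⊔ ltField π m : IntermediateField F (AlgebraicClosure F))) :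
      (E₂ ⊔ ltField π m : IntermediateField F (AlgebraicClosure F)))
  -- `e : N x = σ₁⁻¹ (N (σ₂ x))`
  rw [e]
  change _ = relRestrict hπ E₁ m σ ((relRestrict hπ E₁ m σ).symm
    (@Algebra.norm (E₁ ⊔ ltField π m : IntermediateField F (AlgebraicClosure F))
        (E₂ ⊔ ltField π m : IntermediateField F (AlgebraicClosure F)) _ _
        (towerAlgebra (sup_le_sup_right h (ltField π m)))
        (relRestrict hπ E₂ m σ ((β.val m : unitBall (E₂ ⊔ ltField π m : IntermediateField F (AlgebraicClosure F))) :
          (E₂ ⊔ ltField π m : IntermediateField F (AlgebraicClosure F))))))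
  rw [AlgEquiv.apply_symm_apply]

/-! ### Powers of norm-coherent units -/

variable {hπ} {E : IntermediateField F (AlgebraicClosure F)} [FiniteDimensional F E]

/-- `β^n` (termwise). [cite: deShalit1987, Ch. I §2.3 (i)] -/
def npow (β : RelNormCoherentUnits hπ E) : ℕ → RelNormCoherentUnits hπ E
  | 0 => one
  | n + 1 => (npow β n).mul β

/-- `β^0 = 1`. [cite: deShalit1987, Ch. I §2.3 (i)] -/
@[simp] theorem npow_zero (β : RelNormCoherentUnits hπ E) : β.npow 0 = one := rfl

/-- `β^{n+1} = β^n · β`. [cite: deShalit1987, Ch. I §2.3 (i)] -/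
@[simp] theorem npow_succ (β : RelNormCoherentUnits hπ E) (n : ℕ) : β.npow (n + 1) = (β.npow n).mul β := rfl

/-- Components of `β^n`. [cite: deShalit1987, Ch. I §2.3 (i)] -/
theorem val_npow (β : RelNormCoherentUnits hπ E) (n m : ℕ) : (β.npow n).val m = β.val m ^ n := by
  induction n with
  | zero => rw [npow_zero, val_one, pow_zero]
  | succ n ih => rw [npow_succ, val_mul, ih, pow_succ]

end RelNormCoherentUnits

variable {E : IntermediateField F (AlgebraicClosure F)} [FiniteDimensional F E] [Normal F E] [IsGalois F E]
  (hq : residueFieldCard F = 2) (hE : E ≤ maxUnramified F) {σ₀ : absoluteGaloisGroup F} (hσ₀ : IsAbsArithFrob σ₀)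

/-- `g_{β^n} = g_β^n`. [cite: deShalit1987, Ch. I §2.3 (i)] -/
theorem relColemanSeries_npow (β : RelNormCoherentUnits hπ E) (n : ℕ) :
    relColemanSeries hπ E hq hE hσ₀ (β.npow n) = relColemanSeries hπ E hq hE hσ₀ β ^ n := by
  induction n with
  | zero => rw [RelNormCoherentUnits.npow_zero, relColemanSeries_one, pow_zero]
  | succ n ih => rw [RelNormCoherentUnits.npow_succ, relColemanSeries_mul, ih, pow_succ]

/-- `δ(β^n) = n·δβ`. [cite: deShalit1987, Ch. I §3.4 Lemma (i)] -/
theorem relLogDerivSeries_npow (β : RelNormCoherentUnits hπ E) (n : ℕ) :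
    relLogDerivSeries hπ E hq hE hσ₀ (β.npow n) = n • relLogDerivSeries hπ E hq hE hσ₀ β := by
  induction n with
  | zero => rw [RelNormCoherentUnits.npow_zero, relLogDerivSeries_one, zero_smul]
  | succ n ih => rw [RelNormCoherentUnits.npow_succ, relLogDerivSeries_mul, ih, add_smul, one_smul]

/-- `r_{β^n} = n·r_β`. [cite: deShalit1987, Ch. I §3.4 Lemma (i), §3.7] -/
theorem relUnitCoordTwo_npow (u : (LTCoeff F)ˣ) (hu : LTCoeff.of F π = residueFieldCard F * u) (β : RelNormCoherentUnits hπ E) (n : ℕ) :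
    relUnitCoordTwo hπ E hq hE hσ₀ u hu (β.npow n) = n • relUnitCoordTwo hπ E hq hE hσ₀ u hu β := by
  induction n with
  | zero => rw [RelNormCoherentUnits.npow_zero, relUnitCoordTwo_one, zero_smul]
  | succ n ih => rw [RelNormCoherentUnits.npow_succ, relUnitCoordTwo_mul, ih, add_smul, one_smul]

/-! ### `N_{E₂/E₁} ∘ ι = (·)^{[E₂:E₁]}` -/

variable {E₁ E₂ : IntermediateField F (AlgebraicClosure F)} [FiniteDimensional F E₁] [FiniteDimensional F E₂]
  [Normal F E₁] [Normal F E₂] [IsGalois F E₁] [IsGalois F E₂]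

omit [Normal F E₁] [Normal F E₂] [IsGalois F E₁] [IsGalois F E₂] in
include hπ in
/-- **`[E₂·K_π^{m+1} : E₁·K_π^{m+1}] = [E₂:F]/[E₁:F]`** for `E₁ ≤ E₂ ⊆ F^{nr}` (linear disjointness of the unramified `E_i` and the
totally ramified `K_π^{m+1}`: `[E_i·K : F] = [E_i:F][K:F]`). [cite: deShalit1987, Ch. I §1.8] -/
theorem finrank_towerAlgebra_sup_ltField (h : E₁ ≤ E₂) (hE₂ : E₂ ≤ maxUnramified F) (m : ℕ) :
    @Module.finrank (E₁ ⊔ ltField π m : IntermediateField F (AlgebraicClosure F))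
        (E₂ ⊔ ltField π m : IntermediateField F (AlgebraicClosure F)) _ _
        (towerAlgebra (sup_le_sup_right h (ltField π m))).toModule =
      Module.finrank F E₂ / Module.finrank F E₁ := by
  letI := towerAlgebra (sup_le_sup_right h (ltField π m) : E₁ ⊔ ltField π m ≤ E₂ ⊔ ltField π m)
  haveI := towerAlgebra_isScalarTower (sup_le_sup_right h (ltField π m) : E₁ ⊔ ltField π m ≤ E₂ ⊔ ltField π m)
  have h1 := Module.finrank_mul_finrank F (E₁ ⊔ ltField π m : IntermediateField F (AlgebraicClosure F))
    (E₂ ⊔ ltField π m : IntermediateField F (AlgebraicClosure F))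
  rw [finrank_sup_ltField_of_le_maxUnramified hπ E₁ (h.trans hE₂) m, finrank_sup_ltField_of_le_maxUnramified hπ E₂ hE₂ m] at h1
  have hK : 0 < Module.finrank F (ltField π m) := Module.finrank_pos
  have hE : 0 < Module.finrank F E₁ := Module.finrank_pos
  -- `[E₁:F]·[K:F]·d = [E₂:F]·[K:F]`
  have h2 : Module.finrank F E₁ * @Module.finrank (E₁ ⊔ ltField π m : IntermediateField F (AlgebraicClosure F))
      (E₂ ⊔ ltField π m : IntermediateField F (AlgebraicClosure F)) _ _
      (towerAlgebra (sup_le_sup_right h (ltField π m))).toModule = Module.finrank F E₂ := by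
    apply Nat.eq_of_mul_eq_mul_right hK
    calc Module.finrank F E₁ * @Module.finrank (E₁ ⊔ ltField π m : IntermediateField F (AlgebraicClosure F))
          (E₂ ⊔ ltField π m : IntermediateField F (AlgebraicClosure F)) _ _
          (towerAlgebra (sup_le_sup_right h (ltField π m))).toModule * Module.finrank F (ltField π m)
        = Module.finrank F E₁ * Module.finrank F (ltField π m) *
            @Module.finrank (E₁ ⊔ ltField π m : IntermediateField F (AlgebraicClosure F))
              (E₂ ⊔ ltField π m : IntermediateField F (AlgebraicClosure F)) _ _
              (towerAlgebra (sup_le_sup_right h (ltField π m))).toModule := by ring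
      _ = Module.finrank F E₂ * Module.finrank F (ltField π m) := h1
  rw [← h2, Nat.mul_div_cancel_left _ hE]

/-- ★ **`N_{E₂/E₁}(ι γ) = γ^{[E₂:F]/[E₁:F]}`** for `γ ∈ 𝒰(E₁·K_π^∞)`: the composite of the norm down the base with the base change is
the `[E₂:E₁]`-th power (`N_{L₂/L₁}(x) = x^{[L₂:L₁]}` for `x ∈ L₁`). [cite: deShalit1987, Ch. III §1.2 Lemma (ii)] -/
theorem RelNormCoherentUnits.baseNorm_baseChange (h : E₁ ≤ E₂) (hE₂ : E₂ ≤ maxUnramified F) (γ : RelNormCoherentUnits hπ E₁) :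
    (γ.baseChange hπ hq h hE₂ hσ₀).baseNorm hπ h = γ.npow (Module.finrank F E₂ / Module.finrank F E₁) := by
  refine RelNormCoherentUnits.ext fun m => Subtype.ext ?_
  letI := towerAlgebra (sup_le_sup_right h (ltField π m) : E₁ ⊔ ltField π m ≤ E₂ ⊔ ltField π m)
  rw [RelNormCoherentUnits.coe_val_baseNorm, RelNormCoherentUnits.coe_val_baseChange, RelNormCoherentUnits.val_npow,
    SubmonoidClass.coe_pow, ← towerAlgebra_algebraMap_apply (sup_le_sup_right h (ltField π m)), Algebra.norm_algebraMap,
    finrank_towerAlgebra_sup_ltField hπ h hE₂ m]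

/-- **`ι(r_{N(ιγ)}) = [E₂:E₁] · ι(r_γ)`**: on coordinates, `N ∘ ι` is multiplication by the degree.
[cite: deShalit1987, Ch. I §3.8 (16); Ch. III §1.2 Lemma (ii)] -/
theorem relUnitCoordTwo_baseNorm_baseChange (h : E₁ ≤ E₂) (hE₂ : E₂ ≤ maxUnramified F) (u : (LTCoeff F)ˣ)
    (hu : LTCoeff.of F π = residueFieldCard F * u) (γ : RelNormCoherentUnits hπ E₁) :
    relUnitCoordTwo hπ E₁ hq (h.trans hE₂) hσ₀ u hu ((γ.baseChange hπ hq h hE₂ hσ₀).baseNorm hπ h) =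
      (Module.finrank F E₂ / Module.finrank F E₁) • relUnitCoordTwo hπ E₁ hq (h.trans hE₂) hσ₀ u hu γ := by
  rw [RelNormCoherentUnits.baseNorm_baseChange hπ hq hσ₀ h hE₂, relUnitCoordTwo_npow]

/-! ### The cokernel of `β ↦ r_β` is killed by `1 − u^{[E:F]}` -/

/-- **`c' − u·φ(c') = (1 − u^d)·c` is solvable for every `c ∈ 𝒪_E`** (`d = [E:F]`, `c' = Σ_{i<d} u^iφ^i(c)`, `φ^d = id`): the image of
the anomaly map `1 − uφ` contains `(1 − u^d)𝒪_E`. [cite: deShalit1987, Ch. I §3.7 (the integer `N`)] -/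
theorem exists_sub_mul_frobUnitBall_eq (σ₀ : absoluteGaloisGroup F) (u : LTCoeff F) (c : unitBall E) :
    ∃ c' : unitBall E, c' - algebraMap (LTCoeff F) (unitBall E) u * (frobUnitBall E σ₀ : unitBall E →+* unitBall E) c' =
      (1 - algebraMap (LTCoeff F) (unitBall E) u ^ Module.finrank F E) * c := by
  set φ : unitBall E →+* unitBall E := (frobUnitBall E σ₀ : unitBall E →+* unitBall E) with hφ
  set a : unitBall E := algebraMap (LTCoeff F) (unitBall E) u with ha
  set f : ℕ → unitBall E := fun i => a ^ i * (φ ^ i) c with hf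
  refine ⟨∑ i ∈ Finset.range (Module.finrank F E), f i, ?_⟩
  have hφa : φ a = a := frobUnitBall_algebraMap_LTCoeff E σ₀ u
  have hstep : ∀ i, a * φ (f i) = f (i + 1) := fun i => by
    rw [hf]
    change a * φ (a ^ i * (φ ^ i) c) = a ^ (i + 1) * (φ ^ (i + 1)) c
    rw [map_mul, map_pow, hφa, pow_succ' φ i, RingHom.mul_def, RingHom.comp_apply]
    ring
  have htel : ∑ i ∈ Finset.range (Module.finrank F E), f i - a * φ (∑ i ∈ Finset.range (Module.finrank F E), f i) =
      f 0 - f (Module.finrank F E) := by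
    rw [map_sum, Finset.mul_sum]
    simp_rw [hstep]
    have e := Finset.sum_range_sub f (Module.finrank F E)
    rw [Finset.sum_sub_distrib] at e
    linear_combination -e
  rw [htel, hf]
  change a ^ 0 * (φ ^ 0) c - a ^ Module.finrank F E * (φ ^ Module.finrank F E) c = (1 - a ^ Module.finrank F E) * c
  rw [hφ, frobUnitBall_pow_finrank_apply E σ₀ c, pow_zero, pow_zero, RingHom.one_def, RingHom.id_apply]
  ring

/-- ★ **The cokernel of `𝒰¹(E·K_π^∞) → 𝒪_E⟦Y⟧`, `β ↦ r_β`, is killed by `1 − u^{[E:F]}`**: every `r ∈ 𝒪_E⟦Y⟧` whose constant term lies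
in `(1 − u^{[E:F]})𝒪_E` is the coordinate `r_β` of a PRINCIPAL norm-coherent unit `β` (`π = 2u`, `π ≡ m₁ (mod π²)`).  In de Shalit's
notation `p^N ∥ 1 − u^d`; over `ℤ_p⟦T₁,T₂⟧` such cokernels are pseudo-null. [cite: deShalit1987, Ch. I §3.7 Theorem] -/
theorem exists_principal_relUnitCoordTwo_eq_of_constantCoeff_eq (u : (LTCoeff F)ˣ) (hu : LTCoeff.of F π = residueFieldCard F * u)
    (hm : ∃ m₁ : ℕ, LTCoeff.of F π ^ 2 ∣ LTCoeff.of F π - m₁) (r : PowerSeries (unitBall E)) (c : unitBall E)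
    (hr : PowerSeries.constantCoeff r = (1 - algebraMap (LTCoeff F) (unitBall E) (u : LTCoeff F) ^ Module.finrank F E) * c) :
    ∃ β : RelNormCoherentUnits hπ E,
      ‖((β.val 0 : unitBall (E ⊔ ltField π 0 : IntermediateField F (AlgebraicClosure F))) :
        (E ⊔ ltField π 0 : IntermediateField F (AlgebraicClosure F))) - 1‖ < 1 ∧
      relUnitCoordTwo hπ E hq hE hσ₀ u hu β = r := by
  obtain ⟨c', hc'⟩ := exists_sub_mul_frobUnitBall_eq σ₀ (u : LTCoeff F) c
  exact exists_principal_relUnitCoordTwo_eq hπ E hq hE hσ₀ u hu hm r c' (by rw [hr, hc'])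

end RelativeBaseNormLawsTwo

end Literature.NumberTheory.GaloisRepresentations
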